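/- LEAD seat `ym-line-cbag-p1` (prover-ym-line-cbag-p1-g23-0) leading LINE 7 `GlueballBandRecursion`, crux `OneGlueballBandDichotomy`
(stmt-QuantumFields-27554): the BLOCH DOOR — the complete endgame from an effective one-particle Bloch symbol to the crux
(blueprint §1 + §2 (P2), evidence `blueprint-stub_bandLevels.md` v3 on the item).  Composes the landed thermal door
(…ThermalDoor.lean, sharp form) with the landed flatness theorem (…BandTopFlat.lean) through finite-dimensional spectral bookkeeping
for Hermitian matrices.  Route-dependent only through the thermal door's import of the route file. -/
import Summits.QuantumFields.YangMills.Theorems.GlueballBandRecursionOneGlueballBandDichotomyThermalDoor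
import Summits.QuantumFields.YangMills.Theorems.GlueballBandRecursionOneGlueballBandDichotomyBandTopFlat

/-!
# Route `GlueballBandRecursion`, crux `OneGlueballBandDichotomy` (stmt-QuantumFields-27554): the Bloch door —
# an effective Hermitian Bloch symbol with two-sided trace control implies the crux

What a finite-torus one-particle analysis (the XL item P1 of the blueprint) naturally PRODUCES, per `β` on the strong-coupling window
and `N ≥ L₀`: a `2π`-periodic Hermitian matrix symbol `q ↦ B̃(q) ∈ Herm_n(ℂ)` on `ℝ³` (the Fourier symbol of the translation-invariant
effective one-step transfer matrix of the dressed one-plaquette tube: `n` = orientations × species; a matrix trigonometric polynomial),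
whose values at the lattice angles `θ(p) = 2πp/N` are the Bloch blocks, such that
* (positivity and flatness of log-Rayleigh quotients) for every unit `u`: `Re⟪u, B̃(q)u⟫ > 0` and
  `2·log Re⟪u,B̃(x)u⟫ − K|v|² ≤ log Re⟪u,B̃(x+v)u⟫ + log Re⟪u,B̃(x−v)u⟫` (a uniform C² bound on the symbol; `K` uniform in `β`, `N`);
* (upper gap, EVENTUALLY in the Euclidean time) `x_{m+2}(N) ≤ 2·Σ_p Re tr B̃(θp)^{m+2}` for `m ≥ m₀(β, N)`;
* (lower bound at the crux time) `½·Σ_p Re tr B̃(θp)^{m+2} ≤ x_{m+2}(N)` for `N/4 = m + 2`;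
or else the rank-one escape `q_N = 0` (trivial group, `β = 0`).
THIS FILE (`oneGlueballBandLower_of_blochSymbol`, `oneGlueballBandDichotomy_of_blochSymbol`) proves that this implies
`OneGlueballBandLower` and the crux `OneGlueballBandDichotomy` BY NAME: the weights `w_{(p,i)}` = eigenvalues of `B̃(θp)` are positive,
`Σ_j w_j^t = Σ_p Re tr B̃(θp)^t` (§1 `trace_pow_eq_sum_eigenvalues_pow`), the top slice `p ↦ λ_max B̃(θp)` dominates the log-Rayleigh
quotient of the GLOBAL top eigenvector with equality at its momentum (§1 Rayleigh lemmas), so `Band.bandTop_flat_at_latticeArgmax` makes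
it Gaussian-flat with `κ = 4π²(K+1)`, and the sharp thermal door `Band.oneGlueballBandLower_of_traceAsymptotics_eventually` concludes.

§1 is self-contained finite-dimensional spectral bookkeeping for Hermitian complex matrices (Mathlib's `Matrix.IsHermitian.eigenvectorBasis`,
`spectral_theorem`): `tr(A^t) = Σᵢ λᵢ^t`, `Re⟪u, Au⟫ = Σᵢ λᵢ‖⟪vᵢ,u⟫‖²`, `Re⟪u,Au⟫ ≤ (max λ)‖u‖²`, `Re⟪vᵢ, A vᵢ⟫ = λᵢ`. [folklore]

HONEST FRAMING.  A conditional door; the Bloch symbol with these properties IS the finite-torus one-particle theorem (XL, not in print for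
the periodic torus — template: Borgs–Imbrie CMP 145 (1992) Thm A for ground-state multiplets).  Nothing about the crux, the rung
`ColdDoublingRecursionStrongCoupling` or the Yang–Mills mass gap is proved here.
-/

set_option autoImplicit false

noncomputable section

open scoped InnerProductSpace ComplexOrder
open Filter Topology MeasureTheory Finset Real
open Literature.MathematicalPhysics.QuantumFieldTheory
open Literature.MathematicalPhysics.QuantumFieldTheory.Balaban1983to89.Missing (strongCouplingRadius)
open Summit.QuantumFields.YangMills.Theses.GlueballBandRecursion

namespace Summit.QuantumFields.YangMills.Theorems.GlueballBandRecursion.Band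

/-! ### §1 Finite-dimensional spectral bookkeeping for Hermitian matrices -/

section HermitianMatrix

variable {ι : Type*} [Fintype ι] [DecidableEq ι]

/-- `tr(A^t) = Σᵢ λᵢ^t` for a Hermitian matrix (spectral theorem: `A = U·diag(λ)·U*`). [folklore] -/
theorem trace_pow_eq_sum_eigenvalues_pow {A : Matrix ι ι ℂ} (hA : A.IsHermitian) (t : ℕ) :
    (A ^ t).trace = ∑ i, ((hA.eigenvalues i : ℂ)) ^ t := by
  have hspec := hA.spectral_theorem
  have hpow : A ^ t = Unitary.conjStarAlgAut ℂ _ hA.eigenvectorUnitary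
      ((Matrix.diagonal (RCLike.ofReal ∘ hA.eigenvalues : ι → ℂ)) ^ t) := by
    rw [map_pow, ← hspec]
  rw [hpow, Unitary.conjStarAlgAut_apply, Matrix.diagonal_pow, Matrix.trace_mul_cycle, Unitary.coe_star_mul_self,
    one_mul, Matrix.trace_diagonal]
  simp [Function.comp_apply]

/-- The real part of `tr(A^t)` is `Σᵢ λᵢ^t`. [folklore] -/
theorem re_trace_pow_eq_sum_eigenvalues_pow {A : Matrix ι ι ℂ} (hA : A.IsHermitian) (t : ℕ) :
    ((A ^ t).trace).re = ∑ i, (hA.eigenvalues i) ^ t := by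
  rw [trace_pow_eq_sum_eigenvalues_pow hA t,
    show (∑ i, (hA.eigenvalues i : ℂ) ^ t) = ((∑ i, hA.eigenvalues i ^ t : ℝ) : ℂ) by push_cast; rfl,
    Complex.ofReal_re]

/-- The eigenvector basis diagonalises `toEuclideanLin A`. [folklore] -/
theorem toEuclideanLin_eigenvectorBasis {A : Matrix ι ι ℂ} (hA : A.IsHermitian) (i : ι) :
    Matrix.toEuclideanLin A (hA.eigenvectorBasis i) = (hA.eigenvalues i : ℂ) • hA.eigenvectorBasis i := by
  have h := hA.mulVec_eigenvectorBasis i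
  apply WithLp.ofLp_injective (p := 2)
  rw [Matrix.ofLp_toLpLin, Matrix.toLin'_apply, WithLp.ofLp_smul, h]
  rfl

/-- **Rayleigh expansion**: `⟪u, A u⟫ = Σᵢ λᵢ‖⟪vᵢ, u⟫‖²`. [folklore] -/
theorem inner_toEuclideanLin_eq_sum {A : Matrix ι ι ℂ} (hA : A.IsHermitian) (u : EuclideanSpace ℂ ι) :
    ⟪u, Matrix.toEuclideanLin A u⟫_ℂ =
      ∑ i, (hA.eigenvalues i : ℂ) * ((‖⟪hA.eigenvectorBasis i, u⟫_ℂ‖ ^ 2 : ℝ) : ℂ) := by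
  have hT : (Matrix.toEuclideanLin A).IsSymmetric := Matrix.isSymmetric_toEuclideanLin_iff.mpr hA
  rw [← hA.eigenvectorBasis.sum_inner_mul_inner u (Matrix.toEuclideanLin A u)]
  refine Finset.sum_congr rfl fun i _ => ?_
  rw [← hT (hA.eigenvectorBasis i) u, toEuclideanLin_eigenvectorBasis hA i, inner_smul_left,
    Complex.conj_ofReal, ← inner_conj_symm u (hA.eigenvectorBasis i)]
  have h := RCLike.conj_mul (K := ℂ) ⟪hA.eigenvectorBasis i, u⟫_ℂ
  push_cast
  linear_combination (hA.eigenvalues i : ℂ) * h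

/-- **Rayleigh bound**: if every eigenvalue is `≤ M` then `Re⟪u, A u⟫ ≤ M‖u‖²`. [folklore] -/
theorem re_inner_toEuclideanLin_le {A : Matrix ι ι ℂ} (hA : A.IsHermitian) (u : EuclideanSpace ℂ ι) {M : ℝ}
    (hM : ∀ i, hA.eigenvalues i ≤ M) : RCLike.re ⟪u, Matrix.toEuclideanLin A u⟫_ℂ ≤ M * ‖u‖ ^ 2 := by
  rw [inner_toEuclideanLin_eq_sum hA u, map_sum]
  have h1 : ∀ i, RCLike.re ((hA.eigenvalues i : ℂ) * ((‖⟪hA.eigenvectorBasis i, u⟫_ℂ‖ ^ 2 : ℝ) : ℂ))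
      = hA.eigenvalues i * ‖⟪hA.eigenvectorBasis i, u⟫_ℂ‖ ^ 2 := by
    intro i
    rw [← Complex.ofReal_mul]
    exact Complex.ofReal_re _
  simp_rw [h1]
  rw [← hA.eigenvectorBasis.sum_sq_norm_inner_right u, Finset.mul_sum]
  exact Finset.sum_le_sum fun i _ => mul_le_mul_of_nonneg_right (hM i) (by positivity)

/-- **The Rayleigh quotient of an eigenvector is its eigenvalue**: `Re⟪vᵢ, A vᵢ⟫ = λᵢ`. [folklore] -/
theorem re_inner_toEuclideanLin_eigenvectorBasis {A : Matrix ι ι ℂ} (hA : A.IsHermitian) (i : ι) :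
    RCLike.re ⟪hA.eigenvectorBasis i, Matrix.toEuclideanLin A (hA.eigenvectorBasis i)⟫_ℂ = hA.eigenvalues i := by
  rw [toEuclideanLin_eigenvectorBasis hA i, inner_smul_right, inner_self_eq_norm_sq_to_K,
    hA.eigenvectorBasis.orthonormal.1 i]
  simp

end HermitianMatrix

/-! ### §2 Rank-one escape: `q_N = 0` forces `x ≡ 0` -/

/-- If the rate vanishes then so does every thermal trace excess: `q_N = 0 ⟹ x_{m+2}(N) = 0` (`β ≥ 0`; every sub-dominant eigenvalue is
`≤ q_N λ₊ = 0`). -/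
theorem traceExcess_eq_zero_of_rate_eq_zero {G : Type} [Group G] [TopologicalSpace G] [IsTopologicalGroup G] [CompactSpace G]
    [MeasurableSpace G] [BorelSpace G] (r : LatticeRep G) {β : ℝ} (hβ : 0 ≤ β) (N : ℕ) [NeZero N]
    (hq : (⨅ k : ℕ, traceExcess r.ρ β N (k + 2) ^ ((1 : ℝ) / ((k : ℝ) + 2))) = 0) (m : ℕ) :
    traceExcess r.ρ β N (m + 2) = 0 := by
  classical
  obtain ⟨s, _, b, lam, i₀, -, hle, hL0, -, hx, hrate, -⟩ := exists_eigenData_rate r hβ N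
  have hzero : ∀ i, Function.update (fun i => (lam i / lam i₀) ^ (m + 2)) i₀ 0 i = 0 := by
    intro i
    by_cases hi : i = i₀
    · subst hi
      simp
    · rw [Function.update_of_ne hi]
      have h1 := hrate i hi
      rw [hq, zero_mul] at h1
      have h2 : lam i = 0 := le_antisymm h1 (hle i).1
      show (lam i / lam i₀) ^ (m + 2) = 0
      rw [h2, zero_div, zero_pow (by omega)]
  have hz' : Function.update (fun i => (lam i / lam i₀) ^ (m + 2)) i₀ 0 = fun _ => 0 := funext hzero
  have h := hx m
  rw [hz'] at h
  exact h.unique hasSum_zero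

/-! ### §3 The Bloch door -/

/-- **THE BLOCH DOOR (banked form): an effective Hermitian Bloch symbol with two-sided trace control ⇒ `OneGlueballBandLower`.**
See the module docstring for the reading of the hypothesis. -/
theorem oneGlueballBandLower_of_blochSymbol
    (hB : ∀ (G : Type) [Group G] [TopologicalSpace G] [IsTopologicalGroup G] [CompactSpace G],
      letI : MeasurableSpace G := borel G
      haveI : BorelSpace G := ⟨rfl⟩
      ∀ r : LatticeRep G, ∃ K : ℝ, 0 ≤ K ∧ ∃ L₀ : ℕ, ∀ β : ℝ, 0 ≤ β → β ≤ strongCouplingRadius r.ρ →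
        ∀ (N : ℕ) [NeZero N], L₀ ≤ N →
          (⨅ k : ℕ, traceExcess r.ρ β N (k + 2) ^ ((1 : ℝ) / ((k : ℝ) + 2))) = 0 ∨
          ∃ (n : ℕ) (_ : 0 < n) (Bt : (Fin 3 → ℝ) → Matrix (Fin n) (Fin n) ℂ) (_ : ∀ q, (Bt q).IsHermitian),
            (∀ (q : Fin 3 → ℝ) (z : Fin 3 → ℤ), Bt (fun i => q i + 2 * π * z i) = Bt q) ∧
            (∀ u : EuclideanSpace ℂ (Fin n), ‖u‖ = 1 →
              (∀ q, 0 < RCLike.re ⟪u, Matrix.toEuclideanLin (Bt q) u⟫_ℂ) ∧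
              ∀ x v : Fin 3 → ℝ,
                2 * Real.log (RCLike.re ⟪u, Matrix.toEuclideanLin (Bt x) u⟫_ℂ) - K * ∑ i, v i ^ 2 ≤
                  Real.log (RCLike.re ⟪u, Matrix.toEuclideanLin (Bt (x + v)) u⟫_ℂ) +
                    Real.log (RCLike.re ⟪u, Matrix.toEuclideanLin (Bt (x - v)) u⟫_ℂ)) ∧
            (∃ m₀ : ℕ, ∀ m : ℕ, m₀ ≤ m → traceExcess r.ρ β N (m + 2) ≤
              2 * ∑ p : Fin N × Fin N × Fin N, ((Bt (latticeAngle N p) ^ (m + 2)).trace).re) ∧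
            (∀ m : ℕ, N / 4 = m + 2 →
              (1 / 2 : ℝ) * ∑ p : Fin N × Fin N × Fin N, ((Bt (latticeAngle N p) ^ (m + 2)).trace).re ≤
                traceExcess r.ρ β N (m + 2))) :
    OneGlueballBandLower := by
  refine oneGlueballBandLower_of_traceAsymptotics_eventually fun G _ _ _ _ => ?_
  letI : MeasurableSpace G := borel G
  haveI : BorelSpace G := ⟨rfl⟩
  intro r
  obtain ⟨K, hK, L₀, hL₀⟩ := hB G r
  refine ⟨4 * π ^ 2 * (K + 1), by positivity, L₀, fun β hβ0 hβ N _ hN => ?_⟩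
  rcases hL₀ β hβ0 hβ N hN with hq | ⟨n, hn, Bt, hH, hper, hray, ⟨m₀, hup⟩, hlow⟩
  · -- rank-one escape: the zero family on one label does it
    refine ⟨1, fun _ => 0, fun _ => le_rfl, ⟨0, fun m _ => ?_⟩, fun m _ => ?_, ⟨0, fun p => ⟨0, fun j => ?_⟩⟩⟩
    · rw [traceExcess_eq_zero_of_rate_eq_zero r hβ0 N hq m]
      exact mul_nonneg (by norm_num) (Finset.sum_nonneg fun j _ => by simp)
    · rw [traceExcess_eq_zero_of_rate_eq_zero r hβ0 N hq m]
      simp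
    · simp
  · -- the Bloch family: weights = eigenvalues of the Bloch blocks at the lattice angles
    haveI : NeZero n := ⟨by omega⟩
    set w : (Fin N × Fin N × Fin N) × Fin n → ℝ := fun j => (hH (latticeAngle N j.1)).eigenvalues j.2 with hw
    -- positivity of the weights (Rayleigh quotient of a unit eigenvector)
    have hwpos : ∀ j, 0 < w j := by
      intro j
      have hu : ‖(hH (latticeAngle N j.1)).eigenvectorBasis j.2‖ = 1 := (hH (latticeAngle N j.1)).eigenvectorBasis.orthonormal.1 j.2
      have h := (hray _ hu).1 (latticeAngle N j.1)
      rwa [re_inner_toEuclideanLin_eigenvectorBasis] at h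
    -- the trace identity
    have htr : ∀ t : ℕ, ∑ j, w j ^ t = ∑ p : Fin N × Fin N × Fin N, ((Bt (latticeAngle N p) ^ t).trace).re := by
      intro t
      rw [Fintype.sum_prod_type]
      refine Finset.sum_congr rfl fun p _ => ?_
      rw [re_trace_pow_eq_sum_eigenvalues_pow (hH (latticeAngle N p)) t]
    refine ⟨n, w, fun j => (hwpos j).le, ⟨m₀, fun m hm => by rw [htr]; exact hup m hm⟩,
      fun m hm => by rw [htr]; exact hlow m hm, ?_⟩
    -- the Gaussian shape of the top slice
    -- per-momentum argmax `bmax p` and the global argmax `jstar`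
    have hbmax : ∀ p : Fin N × Fin N × Fin N, ∃ i : Fin n, ∀ i', w (p, i') ≤ w (p, i) := fun p => by
      obtain ⟨i, -, hi⟩ := Finset.exists_max_image Finset.univ (fun i => w (p, i)) Finset.univ_nonempty
      exact ⟨i, fun i' => hi i' (Finset.mem_univ _)⟩
    choose bmax hbmax using hbmax
    obtain ⟨jstar, -, hjstar⟩ := Finset.exists_max_image Finset.univ w Finset.univ_nonempty
    set p₀ : Fin N × Fin N × Fin N := jstar.1 with hp₀
    -- the global top eigenvector and its log-Rayleigh quotient
    set ustar : EuclideanSpace ℂ (Fin n) := (hH (latticeAngle N p₀)).eigenvectorBasis jstar.2 with hustar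
    have hunit : ‖ustar‖ = 1 := (hH (latticeAngle N p₀)).eigenvectorBasis.orthonormal.1 jstar.2
    obtain ⟨hpos, hsd⟩ := hray ustar hunit
    set g : (Fin 3 → ℝ) → ℝ := fun q => Real.log (RCLike.re ⟪ustar, Matrix.toEuclideanLin (Bt q) ustar⟫_ℂ) with hg
    set e : Fin N × Fin N × Fin N → ℝ := fun p => Real.log (w (p, bmax p)) with he
    -- hypotheses of the flatness theorem
    have hper_g : ∀ (x : Fin 3 → ℝ) (z : Fin 3 → ℤ), g (fun i => x i + 2 * π * z i) = g x := fun x z => by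
      simp only [hg, hper x z]
    have hsd_g : ∀ x v : Fin 3 → ℝ, 2 * g x - (K + 1) * ∑ i, v i ^ 2 ≤ g (x + v) + g (x - v) := fun x v => by
      have h := hsd x v
      have h0 : 0 ≤ ∑ i, v i ^ 2 := Finset.sum_nonneg fun i _ => sq_nonneg _
      simp only [hg]
      nlinarith
    have hdom : ∀ p, g (latticeAngle N p) ≤ e p := fun p => by
      simp only [hg, he]
      refine Real.log_le_log (hpos _) ?_
      have h := re_inner_toEuclideanLin_le (hH (latticeAngle N p)) ustar (M := w (p, bmax p)) fun i => hbmax p i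
      rwa [hunit, one_pow, mul_one] at h
    have hglob : ∀ p, w (p, bmax p) ≤ w jstar := fun p => hjstar _ (Finset.mem_univ _)
    have htopval : w (p₀, bmax p₀) = w jstar := le_antisymm (hglob p₀) (by rw [hp₀]; exact hbmax jstar.1 jstar.2)
    have htop : e p₀ ≤ g (latticeAngle N p₀) := by
      simp only [hg, he]
      rw [hustar, re_inner_toEuclideanLin_eigenvectorBasis, htopval]
    have hmax : ∀ p, e p ≤ e p₀ := fun p => by
      simp only [he]
      rw [htopval]
      exact Real.log_le_log (hwpos _) (hglob p)
    -- flatness at the lattice argmax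
    have hflat := fun p => bandTop_flat_at_latticeArgmax g hper_g hsd_g e hdom p₀ htop hmax p
    refine ⟨p₀, fun p => ⟨bmax p, fun j => ?_⟩⟩
    -- `w j · exp(−κ momSq/N²) ≤ w jstar · exp(…) ≤ w (p, bmax p)`
    have hN : (0 : ℝ) < N := by exact_mod_cast Nat.pos_of_ne_zero (NeZero.ne N)
    have hexp : w jstar * Real.exp (-(4 * π ^ 2 * (K + 1) * (momSq N (p - p₀) : ℝ) / (N : ℝ) ^ 2)) ≤ w (p, bmax p) := by
      have h1 : e p₀ - e p ≤ (K + 1) * (2 * π / N) ^ 2 * (momSq N (p - p₀) : ℝ) := hflat p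
      simp only [he] at h1
      rw [htopval] at h1
      -- `log W − log w_p ≤ c` ⟹ `W e^{−c} ≤ w_p`
      have hwp := hwpos (p, bmax p)
      have hW := hwpos jstar
      have h2 : Real.log (w jstar) + (-(4 * π ^ 2 * (K + 1) * (momSq N (p - p₀) : ℝ) / (N : ℝ) ^ 2)) ≤
          Real.log (w (p, bmax p)) := by
        have h3 : (K + 1) * (2 * π / N) ^ 2 * (momSq N (p - p₀) : ℝ) =
            4 * π ^ 2 * (K + 1) * (momSq N (p - p₀) : ℝ) / (N : ℝ) ^ 2 := by
          field_simp
          ring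
        linarith
      calc w jstar * Real.exp (-(4 * π ^ 2 * (K + 1) * (momSq N (p - p₀) : ℝ) / (N : ℝ) ^ 2))
          = Real.exp (Real.log (w jstar) + -(4 * π ^ 2 * (K + 1) * (momSq N (p - p₀) : ℝ) / (N : ℝ) ^ 2)) := by
            rw [Real.exp_add, Real.exp_log hW]
        _ ≤ Real.exp (Real.log (w (p, bmax p))) := Real.exp_le_exp.2 h2
        _ = w (p, bmax p) := Real.exp_log hwp
    exact le_trans (mul_le_mul_of_nonneg_right (hjstar j (Finset.mem_univ j)) (Real.exp_nonneg _)) hexp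

/-- **THE BLOCH DOOR: an effective Hermitian Bloch symbol with two-sided trace control ⇒ the crux `OneGlueballBandDichotomy` BY NAME.** -/
theorem oneGlueballBandDichotomy_of_blochSymbol
    (hB : ∀ (G : Type) [Group G] [TopologicalSpace G] [IsTopologicalGroup G] [CompactSpace G],
      letI : MeasurableSpace G := borel G
      haveI : BorelSpace G := ⟨rfl⟩
      ∀ r : LatticeRep G, ∃ K : ℝ, 0 ≤ K ∧ ∃ L₀ : ℕ, ∀ β : ℝ, 0 ≤ β → β ≤ strongCouplingRadius r.ρ →
        ∀ (N : ℕ) [NeZero N], L₀ ≤ N →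
          (⨅ k : ℕ, traceExcess r.ρ β N (k + 2) ^ ((1 : ℝ) / ((k : ℝ) + 2))) = 0 ∨
          ∃ (n : ℕ) (_ : 0 < n) (Bt : (Fin 3 → ℝ) → Matrix (Fin n) (Fin n) ℂ) (_ : ∀ q, (Bt q).IsHermitian),
            (∀ (q : Fin 3 → ℝ) (z : Fin 3 → ℤ), Bt (fun i => q i + 2 * π * z i) = Bt q) ∧
            (∀ u : EuclideanSpace ℂ (Fin n), ‖u‖ = 1 →
              (∀ q, 0 < RCLike.re ⟪u, Matrix.toEuclideanLin (Bt q) u⟫_ℂ) ∧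
              ∀ x v : Fin 3 → ℝ,
                2 * Real.log (RCLike.re ⟪u, Matrix.toEuclideanLin (Bt x) u⟫_ℂ) - K * ∑ i, v i ^ 2 ≤
                  Real.log (RCLike.re ⟪u, Matrix.toEuclideanLin (Bt (x + v)) u⟫_ℂ) +
                    Real.log (RCLike.re ⟪u, Matrix.toEuclideanLin (Bt (x - v)) u⟫_ℂ)) ∧
            (∃ m₀ : ℕ, ∀ m : ℕ, m₀ ≤ m → traceExcess r.ρ β N (m + 2) ≤
              2 * ∑ p : Fin N × Fin N × Fin N, ((Bt (latticeAngle N p) ^ (m + 2)).trace).re) ∧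
            (∀ m : ℕ, N / 4 = m + 2 →
              (1 / 2 : ℝ) * ∑ p : Fin N × Fin N × Fin N, ((Bt (latticeAngle N p) ^ (m + 2)).trace).re ≤
                traceExcess r.ρ β N (m + 2))) :
    OneGlueballBandDichotomy :=
  oneGlueballBandDichotomy_of_oneGlueballBandLower (oneGlueballBandLower_of_blochSymbol hB)

end Summit.QuantumFields.YangMills.Theorems.GlueballBandRecursion.Band

end
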